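import Summits.ResolutionOfSingularities.ResolutionOfSingularities.Theorems.EquisingularLiftEquisingularLiftNatEquinodalCoordChart
import Summits.ResolutionOfSingularities.ResolutionOfSingularities.Theorems.EquisingularLiftEquisingularLiftNatEquinodalMarkedPointOfCoordVec
import Summits.ResolutionOfSingularities.ResolutionOfSingularities.Theorems.EquisingularLiftEquisingularLiftNatEquinodalSectionFrame
import Summits.ResolutionOfSingularities.ResolutionOfSingularities.Theorems.EquisingularLiftEquisingularLiftNatNDProjChartStalk
import Summits.ResolutionOfSingularities.ResolutionOfSingularities.Theorems.EquisingularLiftEquisingularLiftNatNDProjFrame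
import Summits.ResolutionOfSingularities.ResolutionOfSingularities.Theorems.EquisingularLiftEquisingularLiftNatEquinodalNodeRegularTaylor
import HarnessLib

/-!
# [OURS · L1 W4.5(b) · EL♮(3) · door ν4 «EQUINODAL PLANAR NOSE», brick N-0 (JINIT), core S7 — part 2] THE MARKED POINTS ARE EXACTLY THE SINGULAR POINTS OF `Z̃`
# ★ `not_isRegularLocalRing_redSub_stalk_of_node` (a marked node is a non-regular point of `Z̃`) · ★★ `coreS7_singular_iff` (core S7 of `cores₃`)

res-type-027 g22 (desk WORD g25-5 «CORES SPLIT» default `027 ↔ S7`; g25-9/g25-10 «thread `hZdim`»).  OURS; NOT a statement of any manuscript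
([Hironaka2017] is a candidate under adjudication, nothing of it is asserted); AI-written, weaker than expert review.  No `sorry`; standard axioms; DEF-FREE.
`--supports stmt-ResolutionOfSingularities-20148 --as helper`, counted 0.  EL♮(3) is NOT proved here; resolution in positive characteristic is NOT proved.

WHAT.  Core S7 of the N-0 conditional assembly (res-L1-w45b-nose-w1 ✓ `coreS_of_cores₂/₃`): with the door's data (the reduced plane curve
`Z = V₊(ℓ) ∩ V₊(g)`, `g|_Π` squarefree, marked ordinary nodes `vᵢ` covering the non-regular closed points of `Z̃`, the lifted hyperplane `B̃, L̃, Ñ`, the equinodal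
lift `G̃, nO`, the node sections `𝔰 i = [av i]`, the marked closed points `w i` with `Proj φ (w i) = 𝔰 i 𝔪`, AND the curve clause `dim 𝒪_{Z̃,z} = 1` threaded into
`cores₃`), a closed point `z` of `Z̃` is non-regular iff `z = w i` for some `i`.
* «→» = the certificate's cover clause + ONE call of nose-w1's ✓ `eq_marked_point_of_isCoordVecOf` (p686960).
* «←» = ★ `not_isRegularLocalRing_redSub_stalk_of_node` (k-side, this file): `𝓘⟨Z⟩ = (λ, σ(g|_Π))~` (✓ `NoseModel.isRadical_span_range_pair` + ✓ `setOf_pair_eq` +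
  ✓ `SatLift.projIdealSheaf_eq_vanishingIdeal`, nose-w1's Level C chain verbatim); at `z = w i` with coordinate vector `W = θ ∘ av i` (part 1 ★ `isCoordVecOf_of_section`) the
  chart `D₊(x_{dv i}) = Spec k[t]` at `b` (part 1 ★ `isCoordVecOf_chartι`, ✓ `ND.exists_chartRingHom`: `𝒪_{ℙ³,z} = k[t]_{𝔪_b}`, dim 3, regular), the chart ideal
  `(λ(x_d:=1), σ(g|_Π)(x_d:=1))` (`chartIdeal_projIdealSheaf_span`), `σ(g|_Π)(x_d:=1) ∈ 𝔪_b²` by Taylor at the node (✓ `NodeReg.mem_sq_of_eval_eq_zero_of_eval_pderiv_eq_zero`,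
  ✓ `isHomogeneous_aeval_const_mul`, ✓ `eval_dehomogenize`; the cone over the plane curve is singular along the node's line, so no plane chart is needed), and
  Matsumura 14.2 (Literature ✓ `quotient_isRegularLocalRing_tfae`): regular of dimension `1 = 3 − 2` would make the two generators independent in `𝔪/𝔪²`.
[cite: Matsumura1987, Thm. 14.2] [cite: Hartshorne1977, I Ex. 5.8; II Prop. 2.5 and Prop. 5.9] [folklore]
-/

set_option linter.dupNamespace false -- mandated namespace `Summit.<Summit>.<Problem>` of this single-conjunct summit
set_option linter.overlappingInstances false -- signatures carry `[IsDomain O] [IsDiscreteValuationRing O]`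

noncomputable section

open CategoryTheory CategoryTheory.Limits AlgebraicGeometry TopologicalSpace Topology IsLocalRing
open MvPolynomial
open Literature.AlgebraicGeometry.Resolution
open AlgebraicGeometry.Scheme.IdealSheafData

namespace Summit.ResolutionOfSingularities.ResolutionOfSingularities.Cruxes.EquisingularLiftNat.Sections.Equinodal

/-! ## §5 The chart ideal of `(f)~` -/

section ChartIdeal

variable {k : Type} [Field k] {n c : ℕ}

/-- **The ideal of `(f)~` on the standard chart `D₊(x_d) = Spec k[t]`** is spanned by the dehomogenised forms `f_l(x_d := 1)`.
[cite: Hartshorne1977, II Prop. 2.5 and Prop. 5.9] -/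
theorem chartIdeal_projIdealSheaf_span (f : Fin c → MvPolynomial (Fin (n + 1)) k) (N : Fin c → ℕ)
    (hf : ∀ l, f l ∈ homogeneousSubmodule (Fin (n + 1)) k (N l)) (d : Fin (n + 1)) :
    letI := MvPolynomial.gradedAlgebra (σ := Fin (n + 1)) (R := k)
    (((projIdealSheaf (homogeneousSubmodule (Fin (n + 1)) k) ⟨Ideal.span (Set.range f), isHomogeneous_span_of_forall_mem _ f N hf⟩).comap
        (Literature.AlgebraicGeometry.Motives.ProjectiveSpaceCells.chartι k n d)).ideal ⟨⊤, isAffineOpen_top _⟩).comap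
      (Scheme.ΓSpecIso (CommRingCat.of (MvPolynomial (Fin n) k))).inv.hom =
      Ideal.span (Set.range fun l => Literature.AlgebraicGeometry.Motives.ProjectiveSpace.dehomogenize k d (f l)) := by
  letI := MvPolynomial.gradedAlgebra (σ := Fin (n + 1)) (R := k)
  have h1 : Literature.AlgebraicGeometry.Motives.ProjectiveSpaceCells.chartι k n d =
      Spec.map (CommRingCat.ofHom (Literature.AlgebraicGeometry.Motives.ProjectiveSpace.ofChartRingHom k d)) ≫
        Proj.awayι (homogeneousSubmodule (Fin (n + 1)) k) (X d) (Literature.AlgebraicGeometry.Motives.ProjectiveSpace.X_mem d) zero_lt_one := rfl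
  rw [h1, Scheme.IdealSheafData.comap_comp,
    Summit.ResolutionOfSingularities.ResolutionOfSingularities.Theorems.DepthCone.comap_awayι_projIdealSheaf_span _ f N hf
      (Literature.AlgebraicGeometry.Motives.ProjectiveSpace.X_mem d),
    comap_idealSheaf_specMap, affineBlowup.idealSheaf_ideal_top]
  have hbij : Function.Bijective (Scheme.ΓSpecIso (CommRingCat.of (MvPolynomial (Fin n) k))).inv.hom :=
    (Scheme.ΓSpecIso (CommRingCat.of (MvPolynomial (Fin n) k))).commRingCatIsoToRingEquiv.symm.bijective
  rw [Ideal.comap_map_of_bijective _ hbij, Ideal.map_span, ← Set.range_comp]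
  refine congrArg Ideal.span (congrArg Set.range (funext fun l => ?_))
  change Literature.AlgebraicGeometry.Motives.ProjectiveSpace.ofChartRingHom k d
      (HomogeneousLocalization.Away.mk _ (Literature.AlgebraicGeometry.Motives.ProjectiveSpace.X_mem d) (N l) (f l) _) = _
  exact Literature.AlgebraicGeometry.Motives.ProjectiveSpace.ofChartRingHom_mk d (N l) (f l) _

end ChartIdeal


/-! ## §6 A marked node is not a regular point of `Z̃` -/

section Node

/-- Regularity of `V(I)` at `z` over a named point `x`. [folklore] (Literature `isRegularLocalRing_stalk_subscheme_iff`) -/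
theorem isRegularLocalRing_redSub_stalk_iff_of_eq {X : Scheme.{0}} (I : X.IdealSheafData) (z : ↥I.subscheme) (x : X)
    (hz : I.subschemeι z = x) :
    IsRegularLocalRing (I.subscheme.presheaf.stalk z) ↔ IsRegularLocalRing (X.presheaf.stalk x ⧸ stalkIdeal I x) := by
  subst hz
  exact isRegularLocalRing_stalk_subscheme_iff I z

/-- The dimension of `V(I)` at `z` over a named point `x`. [folklore] (Literature `ringKrullDim_stalk_subscheme`) -/
theorem ringKrullDim_redSub_stalk_of_eq {X : Scheme.{0}} (I : X.IdealSheafData) (z : ↥I.subscheme) (x : X)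
    (hz : I.subschemeι z = x) :
    ringKrullDim (I.subscheme.presheaf.stalk z) = ringKrullDim (X.presheaf.stalk x ⧸ stalkIdeal I x) := by
  subst hz
  exact ringKrullDim_stalk_subscheme I z

/-- **A MARKED NODE IS NOT A REGULAR POINT OF THE REDUCED CURVE** (the «←» half of core S7, k-side).  On `ℙ³_k` let `Z` be closed with
`𝓘⟨Z⟩ = (f₀, f₁)~` for forms `f₀, f₁`, and let `f₁ = G(u)` be the pull-back of a form `G` along polynomials `u_j`; let the closed point `z ∈ Z̃` have a
coordinate vector `W` (`W d = 1`) with `u_j(W) = c · v_j` (`c ≠ 0`) where `G(v) = 0` and `∇G(v) = 0` (a singular point of `V(G)`).  If `dim 𝒪_{Z̃,z} = 1`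
(the door's curve clause) then `𝒪_{Z̃,z}` is NOT regular.  Proof: in the chart `D₊(x_d) = Spec k[t]` at `b = (W_j)_{j ≠ d}` (✓ `ND.exists_chartRingHom`:
`𝒪_{ℙ³,z} = k[t]_{𝔪_b}` of dimension `3`, regular by ✓ `isRegular_projectiveSpace`), `𝒪_{Z̃,z} = 𝒪/(f₀', f₁')` with `f_l' =` the germ of `f_l(x_d := 1)`
(`chartIdeal_projIdealSheaf_span`); Taylor (✓ `NodeReg.mem_sq_of_eval_eq_zero_of_eval_pderiv_eq_zero`) and homogeneity give `f₁' ∈ 𝔪²`; if `𝒪/(f₀', f₁')`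
were regular of dimension `1 = 3 − 2`, Matsumura 14.2 (Literature ✓ `quotient_isRegularLocalRing_tfae`) would make `f₀', f₁'` independent in `𝔪/𝔪²`.
[cite: Matsumura1987, Thm. 14.2] [cite: Hartshorne1977, I Ex. 5.8 and II Prop. 2.5] -/
theorem not_isRegularLocalRing_redSub_stalk_of_node (k : Type) [Field k] :
    letI := MvPolynomial.gradedAlgebra (σ := Fin (3 + 1)) (R := k)
    ∀ (Z : Set (Literature.AlgebraicGeometry.Motives.projectiveSpace 3 k).left) (hZ : IsClosed Z)
      (f : Fin 2 → MvPolynomial (Fin (3 + 1)) k) (N : Fin 2 → ℕ) (hf : ∀ l, f l ∈ homogeneousSubmodule (Fin (3 + 1)) k (N l)),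
      projIdealSheaf (homogeneousSubmodule (Fin (3 + 1)) k) ⟨Ideal.span (Set.range f), isHomogeneous_span_of_forall_mem _ f N hf⟩ =
        vanishingIdeal (⟨Z, hZ⟩ : Closeds (Literature.AlgebraicGeometry.Motives.projectiveSpace 3 k).left) →
    ∀ {τ : Type} [Fintype τ] [DecidableEq τ] (G : MvPolynomial τ k) {e : ℕ}, G.IsHomogeneous e →
    ∀ (u : τ → MvPolynomial (Fin (3 + 1)) k), f 1 = aeval u G →
    ∀ (v : τ → k), eval v G = 0 → (∀ j, eval v (pderiv j G) = 0) →
    ∀ (W : Fin (3 + 1) → k) (d : Fin (3 + 1)), W d = 1 → ∀ (c : k), c ≠ 0 → (∀ j, eval W (u j) = c * v j) →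
    ∀ (z : ↥(redSub (Literature.AlgebraicGeometry.Motives.projectiveSpace 3 k).left Z hZ)),
      IsCoordVecOf k 3 W (redSubι (Literature.AlgebraicGeometry.Motives.projectiveSpace 3 k).left Z hZ z) →
      ringKrullDim ((redSub (Literature.AlgebraicGeometry.Motives.projectiveSpace 3 k).left Z hZ).presheaf.stalk z) = ((1 : ℕ) : WithBot ℕ∞) →
      ¬ IsRegularLocalRing ((redSub (Literature.AlgebraicGeometry.Motives.projectiveSpace 3 k).left Z hZ).presheaf.stalk z) := by
  letI := MvPolynomial.gradedAlgebra (σ := Fin (3 + 1)) (R := k)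
  intro Z hZ f N hf hJ τ _ _ G e hG u hfu v hG0 hG1 W d hWd c hc huW z hzW hZdim hreg
  classical
  -- the chart `D₊(x_d) = Spec k[t]` and the rational point `b` under `z`
  obtain ⟨b, hbdef⟩ : ∃ b : Fin 3 → k, b = fun j => W (d.succAbove j) := ⟨_, rfl⟩
  have hWb : Fin.insertNth (α := fun _ => k) d 1 b = W := by
    funext a
    refine Fin.succAboveCases d ?_ (fun j => ?_) a
    · simp [hWd]
    · simp [hbdef]
  let y₀ : Spec (CommRingCat.of (MvPolynomial (Fin 3) k)) := ⟨MvPolynomial.vanishingIdeal k {b}, inferInstance⟩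
  have hy₀ : y₀.asIdeal = MvPolynomial.vanishingIdeal k {b} := rfl
  have hx : Literature.AlgebraicGeometry.Motives.ProjectiveSpaceCells.chartι k 3 d y₀ =
      redSubι (Literature.AlgebraicGeometry.Motives.projectiveSpace 3 k).left Z hZ z := by
    have h := isCoordVecOf_chartι d b y₀ hy₀
    rw [hWb] at h
    exact eq_of_isCoordVecOf h hzW
  -- the chart ring map `χ : k[t] → R = 𝒪_{ℙ³,z}`
  obtain ⟨χ, hloc, -, hstalk, -⟩ := ND.exists_chartRingHom k 3 d y₀
  letI := χ.toAlgebra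
  haveI := hloc
  have hdimR := ND.ringKrullDim_stalk_eq_of_isLocalization k 3 d b y₀ hy₀ χ hloc
  haveI hRreg : IsRegularLocalRing ((Literature.AlgebraicGeometry.Motives.projectiveSpace 3 k).left.presheaf.stalk
      (Literature.AlgebraicGeometry.Motives.ProjectiveSpaceCells.chartι k 3 d y₀)) := isRegular_projectiveSpace 3 k _
  have hmax : Ideal.map χ y₀.asIdeal = maximalIdeal _ :=
    IsLocalization.AtPrime.map_eq_maximalIdeal y₀.asIdeal
      ((Literature.AlgebraicGeometry.Motives.projectiveSpace 3 k).left.presheaf.stalk (Literature.AlgebraicGeometry.Motives.ProjectiveSpaceCells.chartι k 3 d y₀))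
  have hmem : ∀ p : MvPolynomial (Fin 3) k, χ p ∈ maximalIdeal _ ↔ eval b p = 0 := fun p => by
    rw [show χ p = algebraMap _ ((Literature.AlgebraicGeometry.Motives.projectiveSpace 3 k).left.presheaf.stalk
        (Literature.AlgebraicGeometry.Motives.ProjectiveSpaceCells.chartι k 3 d y₀)) p from rfl,
      IsLocalization.AtPrime.to_map_mem_maximal_iff _ y₀.asIdeal p, hy₀, MvPolynomial.mem_vanishingIdeal_singleton_iff]
    rfl
  -- evaluation through the chart: `(f(x_d := 1))(b) = f(W)`
  have hbW : ∀ F : MvPolynomial (Fin (3 + 1)) k, eval b (Literature.AlgebraicGeometry.Motives.ProjectiveSpace.dehomogenize k d F) = eval W F := by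
    intro F; rw [hbdef]; exact Literature.AlgebraicGeometry.Motives.ProjectiveSpace.eval_dehomogenize d W hWd F
  -- `z ∈ Z`, so the `f_l` vanish at `W`
  have hzZ : (redSubι (Literature.AlgebraicGeometry.Motives.projectiveSpace 3 k).left Z hZ z :
      (Literature.AlgebraicGeometry.Motives.projectiveSpace 3 k).left) ∈
      ((projIdealSheaf (homogeneousSubmodule (Fin (3 + 1)) k) ⟨Ideal.span (Set.range f), isHomogeneous_span_of_forall_mem _ f N hf⟩).support :
        Set (Proj (homogeneousSubmodule (Fin (3 + 1)) k))) := by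
    have h := Set.mem_range_self (f := (redSubι (Literature.AlgebraicGeometry.Motives.projectiveSpace 3 k).left Z hZ).base) z
    rw [Scheme.IdealSheafData.range_subschemeι, ← hJ] at h
    exact h
  rw [CILift.support_projIdealSheaf_span f N hf] at hzZ
  have hevW : ∀ l, eval W (f l) = 0 := fun l => (hzW (N l) (f l) (hf l)).mp (hzZ l)
  -- the stalk of `𝓘⟨Z⟩` at `z` is `(f₀', f₁')`
  have hgen : stalkIdeal (vanishingIdeal (⟨Z, hZ⟩ : Closeds (Literature.AlgebraicGeometry.Motives.projectiveSpace 3 k).left))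
      (Literature.AlgebraicGeometry.Motives.ProjectiveSpaceCells.chartι k 3 d y₀) =
      Ideal.span {χ (Literature.AlgebraicGeometry.Motives.ProjectiveSpace.dehomogenize k d (f 0)),
        χ (Literature.AlgebraicGeometry.Motives.ProjectiveSpace.dehomogenize k d (f 1))} := by
    rw [← hJ, hstalk]
    erw [chartIdeal_projIdealSheaf_span f N hf d]
    rw [Ideal.map_span, ← Set.range_comp]
    congr 1
    ext t
    simp only [Set.mem_range, Function.comp_apply, Set.mem_insert_iff, Set.mem_singleton_iff, Fin.exists_fin_two, eq_comm]
  -- regularity and dimension of `𝒪_{Z̃,z}` in terms of `R ⧸ (f₀', f₁')`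
  have hreg' := (isRegularLocalRing_redSub_stalk_iff_of_eq _ z _ hx.symm).mp hreg
  have hdim' := (ringKrullDim_redSub_stalk_of_eq _ z _ hx.symm).symm.trans hZdim
  rw [hgen] at hreg' hdim'
  -- the two generators lie in `𝔪`, and `f₁' ∈ 𝔪²`
  have hm0 : χ (Literature.AlgebraicGeometry.Motives.ProjectiveSpace.dehomogenize k d (f 0)) ∈ maximalIdeal _ :=
    (hmem _).mpr (by rw [hbW, hevW])
  have hm1 : χ (Literature.AlgebraicGeometry.Motives.ProjectiveSpace.dehomogenize k d (f 1)) ∈ maximalIdeal _ :=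
    (hmem _).mpr (by rw [hbW, hevW])
  have hsq : χ (Literature.AlgebraicGeometry.Motives.ProjectiveSpace.dehomogenize k d (f 1)) ∈ (maximalIdeal _) ^ 2 := by
    -- Taylor at the node, pushed along the substitution `U_j = c⁻¹ · u_j(x_d := 1)` (`U_j(b) = v_j`)
    set U : τ → MvPolynomial (Fin 3) k := fun j => C c⁻¹ * Literature.AlgebraicGeometry.Motives.ProjectiveSpace.dehomogenize k d (u j) with hU
    have hUb : ∀ j, eval b (U j) = v j := by
      intro j
      simp only [hU, map_mul, eval_C, hbW, huW]
      rw [← mul_assoc, inv_mul_cancel₀ hc, one_mul]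
    have hTaylor := NodeReg.mem_sq_of_eval_eq_zero_of_eval_pderiv_eq_zero v G hG0 hG1
    have hmapU : (Ideal.span (Set.range fun j => X j - C (v j))).map (aeval U).toRingHom ≤ y₀.asIdeal := by
      rw [Ideal.map_span, Ideal.span_le]
      rintro _ ⟨_, ⟨j, rfl⟩, rfl⟩
      rw [SetLike.mem_coe, hy₀, MvPolynomial.mem_vanishingIdeal_singleton_iff]
      change eval b ((aeval U) (X j - C (v j))) = 0
      rw [map_sub, aeval_X, aeval_C, map_sub, hUb]
      simp
    have h2 : aeval U G ∈ y₀.asIdeal ^ 2 := by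
      have h := Ideal.mem_map_of_mem (aeval U).toRingHom hTaylor
      rw [Ideal.map_pow] at h
      exact Ideal.pow_right_mono hmapU 2 h
    have h3 : Literature.AlgebraicGeometry.Motives.ProjectiveSpace.dehomogenize k d (f 1) = C (c ^ e) * aeval U G := by
      rw [hfu, ← AlgHom.comp_apply, MvPolynomial.comp_aeval]
      have hfun : (fun j => Literature.AlgebraicGeometry.Motives.ProjectiveSpace.dehomogenize k d (u j)) = fun j => C c * U j := by
        funext j
        rw [hU, ← mul_assoc, ← map_mul, mul_inv_cancel₀ hc, map_one, one_mul]
      rw [hfun, Literature.AlgebraicGeometry.Motives.ProjectiveSpace.isHomogeneous_aeval_const_mul hG (C c) U, map_pow]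
    have h4 : Literature.AlgebraicGeometry.Motives.ProjectiveSpace.dehomogenize k d (f 1) ∈ y₀.asIdeal ^ 2 := by
      rw [h3]; exact Ideal.mul_mem_left _ _ h2
    have h5 := Ideal.mem_map_of_mem χ h4
    rw [Ideal.map_pow, hmax] at h5
    exact h5
  -- Matsumura 14.2 at `S = {f₀', f₁'}`: regular of dimension `1 = 3 − 2` would make `f₁'` non-zero in `𝔪/𝔪²`
  by_cases h01 : χ (Literature.AlgebraicGeometry.Motives.ProjectiveSpace.dehomogenize k d (f 0)) =
      χ (Literature.AlgebraicGeometry.Motives.ProjectiveSpace.dehomogenize k d (f 1))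
  · -- degenerate presentation `(f₁', f₁') = (f₁')`
    rw [h01, Set.pair_eq_singleton] at hreg' hdim'
    by_cases h10 : χ (Literature.AlgebraicGeometry.Motives.ProjectiveSpace.dehomogenize k d (f 1)) = 0
    · rw [h10, Ideal.span_singleton_eq_bot.mpr rfl, ringKrullDim_eq_of_ringEquiv (RingEquiv.quotientBot _), hdimR] at hdim'
      norm_num at hdim'
    · haveI := hreg'
      exact notMem_sq_of_isRegularLocalRing_quotient hm1 h10 hsq
  · let S : Finset ((Literature.AlgebraicGeometry.Motives.projectiveSpace 3 k).left.presheaf.stalk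
        (Literature.AlgebraicGeometry.Motives.ProjectiveSpaceCells.chartι k 3 d y₀)) :=
      {χ (Literature.AlgebraicGeometry.Motives.ProjectiveSpace.dehomogenize k d (f 0)),
        χ (Literature.AlgebraicGeometry.Motives.ProjectiveSpace.dehomogenize k d (f 1))}
    have hScoe : (S : Set ((Literature.AlgebraicGeometry.Motives.projectiveSpace 3 k).left.presheaf.stalk (Literature.AlgebraicGeometry.Motives.ProjectiveSpaceCells.chartι k 3 d y₀))) = {χ (Literature.AlgebraicGeometry.Motives.ProjectiveSpace.dehomogenize k d (f 0)),
        χ (Literature.AlgebraicGeometry.Motives.ProjectiveSpace.dehomogenize k d (f 1))} := Finset.coe_pair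
    have hsub : (S : Set ((Literature.AlgebraicGeometry.Motives.projectiveSpace 3 k).left.presheaf.stalk (Literature.AlgebraicGeometry.Motives.ProjectiveSpaceCells.chartι k 3 d y₀))) ⊆ (maximalIdeal ((Literature.AlgebraicGeometry.Motives.projectiveSpace 3 k).left.presheaf.stalk (Literature.AlgebraicGeometry.Motives.ProjectiveSpaceCells.chartι k 3 d y₀)) : Set ((Literature.AlgebraicGeometry.Motives.projectiveSpace 3 k).left.presheaf.stalk (Literature.AlgebraicGeometry.Motives.ProjectiveSpaceCells.chartι k 3 d y₀))) := by
      rw [hScoe]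
      rintro t (rfl | ht)
      · exact hm0
      · rw [Set.mem_singleton_iff] at ht; subst ht; exact hm1
    have hcard : S.card = 2 := Finset.card_pair h01
    rw [← hScoe] at hreg' hdim'
    have htfae := quotient_isRegularLocalRing_tfae _ S hsub
    have h3 : IsRegularLocalRing (((Literature.AlgebraicGeometry.Motives.projectiveSpace 3 k).left.presheaf.stalk (Literature.AlgebraicGeometry.Motives.ProjectiveSpaceCells.chartι k 3 d y₀)) ⧸ Ideal.span (S : Set ((Literature.AlgebraicGeometry.Motives.projectiveSpace 3 k).left.presheaf.stalk (Literature.AlgebraicGeometry.Motives.ProjectiveSpaceCells.chartι k 3 d y₀)))) ∧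
        ringKrullDim (((Literature.AlgebraicGeometry.Motives.projectiveSpace 3 k).left.presheaf.stalk (Literature.AlgebraicGeometry.Motives.ProjectiveSpaceCells.chartι k 3 d y₀)) ⧸ Ideal.span (S : Set ((Literature.AlgebraicGeometry.Motives.projectiveSpace 3 k).left.presheaf.stalk (Literature.AlgebraicGeometry.Motives.ProjectiveSpaceCells.chartι k 3 d y₀)))) + S.card = ringKrullDim ((Literature.AlgebraicGeometry.Motives.projectiveSpace 3 k).left.presheaf.stalk (Literature.AlgebraicGeometry.Motives.ProjectiveSpaceCells.chartι k 3 d y₀)) :=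
      ⟨hreg', by rw [hdim', hcard, hdimR, ← Nat.cast_add]⟩
    have hli := (htfae.out 2 1).mp h3
    have hGS : χ (Literature.AlgebraicGeometry.Motives.ProjectiveSpace.dehomogenize k d (f 1)) ∈ (S : Set ((Literature.AlgebraicGeometry.Motives.projectiveSpace 3 k).left.presheaf.stalk (Literature.AlgebraicGeometry.Motives.ProjectiveSpaceCells.chartι k 3 d y₀))) := by
      rw [hScoe]; exact Set.mem_insert_of_mem _ (Set.mem_singleton _)
    refine hli.ne_zero ⟨_, hGS⟩ ?_
    change (maximalIdeal ((Literature.AlgebraicGeometry.Motives.projectiveSpace 3 k).left.presheaf.stalk (Literature.AlgebraicGeometry.Motives.ProjectiveSpaceCells.chartι k 3 d y₀))).toCotangent ⟨χ (Literature.AlgebraicGeometry.Motives.ProjectiveSpace.dehomogenize k d (f 1)), hsub hGS⟩ = 0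
    exact (Ideal.toCotangent_eq_zero _ _).mpr hsq

end Node


/-! ## §7 Core S7 of `cores₃` -/

section CoreS7

set_option maxHeartbeats 1600000 in -- sixty binders in context: the default budget times out on routine rewrites
/-- ★★ **CORE S7 OF THE N-0 ASSEMBLY (`cores₃` of `coreS_of_cores₃`)**: under the `cores₃` binders (door data, certificate, lifted hyperplane, equinodal lift,
degree certificates, node sections `𝔰 i = [av i]`, marked closed points `w i`, WITH the curve clause `hZdim`), a closed point `z` of `Z̃` is non-regular iff
`z = w i` for some `i`.  «→»: cover clause + ✓ `eq_marked_point_of_isCoordVecOf`; «←»: ★ `not_isRegularLocalRing_redSub_stalk_of_node` at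
`(λ, σ(g|_Π))~ = 𝓘⟨Z⟩`, `W = θ ∘ av i`, `c = θ(u)⁻¹`.  See the module docstring. [OURS · brick N-0 · core S7; counted 0] -/
theorem coreS7_singular_iff (k : Type) [Field k] [IsAlgClosed k] :
    ∀ (O : Type) [CommRing O] [IsDomain O] [IsDiscreteValuationRing O] [IsAdicComplete (IsLocalRing.maximalIdeal O) O]
        [IsAlgClosed (IsLocalRing.ResidueField O)] (θ : O →+* k), Function.Surjective θ →
      (letI := MvPolynomial.gradedAlgebra (σ := Fin (3 + 1)) (R := O); letI := MvPolynomial.gradedAlgebra (σ := Fin (3 + 1)) (R := k);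
       ∀ (φ : MvPolynomial.homogeneousSubmodule (Fin (3 + 1)) O →+*ᵍ MvPolynomial.homogeneousSubmodule (Fin (3 + 1)) k)
        (hφ' : HomogeneousIdeal.irrelevant (MvPolynomial.homogeneousSubmodule (Fin (3 + 1)) k) ≤ (HomogeneousIdeal.irrelevant (MvPolynomial.homogeneousSubmodule (Fin (3 + 1)) O)).map φ), (∀ s, φ s = MvPolynomial.map θ s) →
        AlgebraicGeometry.IsIntegral (AlgebraicGeometry.Proj (MvPolynomial.homogeneousSubmodule (Fin (3 + 1)) O)) → IsLocallyNoetherian (AlgebraicGeometry.Proj (MvPolynomial.homogeneousSubmodule (Fin (3 + 1)) O)) → Literature.AlgebraicGeometry.Resolution.Scheme.IsRegular (AlgebraicGeometry.Proj (MvPolynomial.homogeneousSubmodule (Fin (3 + 1)) O)) → AlgebraicGeometry.IsProper (AlgebraicGeometry.Proj.toSpecZero (MvPolynomial.homogeneousSubmodule (Fin (3 + 1)) O) ≫ AlgebraicGeometry.Spec.map (CommRingCat.ofHom (algebraMap O (MvPolynomial.homogeneousSubmodule (Fin (3 + 1)) O 0)))) → AlgebraicGeometry.SmoothOfRelativeDimension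 3 (AlgebraicGeometry.Proj.toSpecZero (MvPolynomial.homogeneousSubmodule (Fin (3 + 1)) O) ≫ AlgebraicGeometry.Spec.map (CommRingCat.ofHom (algebraMap O (MvPolynomial.homogeneousSubmodule (Fin (3 + 1)) O 0)))) →
      -- the door's `ℓ`, `Z` and the CERTIFICATE data (`EqCertAt₀ k 3 ℓ Z hZ` unpacked)
      ∀ (ℓ : MvPolynomial (Fin (3 + 1)) k) (Z : Set (Literature.AlgebraicGeometry.Motives.projectiveSpace 3 k).left) (hZ : IsClosed Z) (e δ : ℕ) (g : MvPolynomial (Fin (3 + 1)) k)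
        (B : Fin (3 + 1) → Fin 3 → k) (c a b : Fin 3) (v : Fin δ → Fin 3 → k) (r : Fin 3 → Fin (3 + 1)),
        g.IsHomogeneous e → Squarefree (restrictToHyperplane B g) →
        Z = {y : (Literature.AlgebraicGeometry.Motives.projectiveSpace 3 k).left | ℓ ∈ (y : ProjectiveSpectrum (MvPolynomial.homogeneousSubmodule (Fin (3 + 1)) k)).asHomogeneousIdeal ∧ g ∈ (y : ProjectiveSpectrum (MvPolynomial.homogeneousSubmodule (Fin (3 + 1)) k)).asHomogeneousIdeal} →
        restrictToHyperplane B ℓ = 0 → Function.Injective r → ((c : ℕ) = 2 ∧ (a : ℕ) = 0 ∧ (b : ℕ) = 1) →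
        (∀ i, v i c = 1 ∧ MvPolynomial.eval (v i) (restrictToHyperplane B g) = 0 ∧
          (∀ j, MvPolynomial.eval (v i) (MvPolynomial.pderiv j (restrictToHyperplane B g)) = 0) ∧ hessBlock (restrictToHyperplane B g) a b (v i) ≠ 0) →
        (∀ z : ↥(redSub (Literature.AlgebraicGeometry.Motives.projectiveSpace 3 k).left Z hZ), IsClosed ({z} : Set ↥(redSub (Literature.AlgebraicGeometry.Motives.projectiveSpace 3 k).left Z hZ)) → ¬ IsRegularLocalRing ((redSub (Literature.AlgebraicGeometry.Motives.projectiveSpace 3 k).left Z hZ).presheaf.stalk z) →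
          ∃ i, IsCoordVecOf k 3 (fun s => ∑ j, B s j * v i j) (redSubι (Literature.AlgebraicGeometry.Motives.projectiveSpace 3 k).left Z hZ z : (Literature.AlgebraicGeometry.Motives.projectiveSpace 3 k).left)) →
        Function.Injective v →
        (∀ z : ↥(redSub (Literature.AlgebraicGeometry.Motives.projectiveSpace 3 k).left Z hZ), IsClosed ({z} : Set ↥(redSub (Literature.AlgebraicGeometry.Motives.projectiveSpace 3 k).left Z hZ)) →
              ringKrullDim ((redSub (Literature.AlgebraicGeometry.Motives.projectiveSpace 3 k).left Z hZ).presheaf.stalk z) = ((1 : ℕ) : WithBot ℕ∞)) →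
      -- the LIFTED HYPERPLANE data (✓ `HyperplaneLift.exists_hyperplane_lift`)
      ∀ (a₀ : Fin (3 + 1)) (Bt : Fin (3 + 1) → Fin 3 → O) (ct : Fin (3 + 1) → O) (Nt : Fin 3 → Fin 3 → O),
        (∀ j, r j ≠ a₀) → (∀ a' j, θ (Bt a' j) = B a' j) → IsUnit (Matrix.of fun j j' : Fin 3 => Bt (r j) j').det → ct a₀ = 1 →
        MvPolynomial.aeval (fun a' : Fin (3 + 1) => ∑ j : Fin 3, MvPolynomial.C (Bt a' j) * MvPolynomial.X j) (∑ a, MvPolynomial.C (ct a) * MvPolynomial.X a : MvPolynomial (Fin (3 + 1)) O) = 0 →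
        (∀ G : MvPolynomial (Fin 3) O, MvPolynomial.aeval (fun a' : Fin (3 + 1) => ∑ j : Fin 3, MvPolynomial.C (Bt a' j) * MvPolynomial.X j)
          (MvPolynomial.aeval (fun i : Fin 3 => ∑ j : Fin 3, MvPolynomial.C (Nt i j) * MvPolynomial.X (r j)) G) = G) →
        (∀ f : MvPolynomial (Fin (3 + 1)) O, MvPolynomial.aeval (fun a' : Fin (3 + 1) => ∑ j : Fin 3, MvPolynomial.C (Bt a' j) * MvPolynomial.X j) f = 0 → (∑ a, MvPolynomial.C (ct a) * MvPolynomial.X a : MvPolynomial (Fin (3 + 1)) O) ∣ f) →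
        {y : (Literature.AlgebraicGeometry.Motives.projectiveSpace 3 k).left | ℓ ∈ (y : ProjectiveSpectrum (MvPolynomial.homogeneousSubmodule (Fin (3 + 1)) k)).asHomogeneousIdeal} = {y : (Literature.AlgebraicGeometry.Motives.projectiveSpace 3 k).left | (∑ a', MvPolynomial.C (θ (ct a')) * MvPolynomial.X a' : MvPolynomial (Fin (3 + 1)) k) ∈ (y : ProjectiveSpectrum (MvPolynomial.homogeneousSubmodule (Fin (3 + 1)) k)).asHomogeneousIdeal} →
      -- the EQUINODAL LIFT (✓ `exists_equinodal_lift_of_cert_of_surjective`)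
      ∀ (Gt : MvPolynomial (Fin 3) O) (nO : Fin δ → Fin 3 → O),
        Gt.IsHomogeneous e → MvPolynomial.map θ Gt = restrictToHyperplane B g → (∀ i j, θ (nO i j) = v i j) → (∀ i, nO i 2 = 1) →
        (∀ i, MvPolynomial.eval (nO i) Gt = 0 ∧ ∀ j, MvPolynomial.eval (nO i) (MvPolynomial.pderiv j Gt) = 0) →
        (∀ i, IsUnit (MvPolynomial.eval (nO i) (MvPolynomial.pderiv 0 (MvPolynomial.pderiv 0 Gt)) * MvPolynomial.eval (nO i) (MvPolynomial.pderiv 1 (MvPolynomial.pderiv 1 Gt))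
          - MvPolynomial.eval (nO i) (MvPolynomial.pderiv 0 (MvPolynomial.pderiv 1 Gt)) ^ 2)) →
      -- the two models' degree certificates (so the ideal sheaves below are well-formed)
      ∀ (hL : ∀ l, (![(∑ a, MvPolynomial.C (ct a) * MvPolynomial.X a : MvPolynomial (Fin (3 + 1)) O)] : Fin 1 → MvPolynomial (Fin (3 + 1)) O) l ∈ MvPolynomial.homogeneousSubmodule (Fin (3 + 1)) O ((![1] : Fin 1 → ℕ) l))
        (hF : ∀ l, (![(∑ a, MvPolynomial.C (ct a) * MvPolynomial.X a : MvPolynomial (Fin (3 + 1)) O), (MvPolynomial.aeval (fun i : Fin 3 => ∑ j : Fin 3, MvPolynomial.C (Nt i j) * MvPolynomial.X (r j)) Gt : MvPolynomial (Fin (3 + 1)) O)] : Fin 2 → MvPolynomial (Fin (3 + 1)) O) l ∈ MvPolynomial.homogeneousSubmodule (Fin (3 + 1)) O ((![1, e] : Fin 2 → ℕ) l)),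
      -- the NODE SECTIONS `𝔰 i = [av i]`, `av i = uᵢ⁻¹ • B̃·nO i` (✓ SectionOfVec), and the marked closed points `w i`
      ∀ (av : Fin δ → Fin (3 + 1) → O) (dv : Fin δ → Fin (3 + 1)) (hav : ∀ i, av i (dv i) = 1),
        (∀ i, ∃ u : O, IsUnit u ∧ ∀ a', u * av i a' = ∑ j : Fin 3, Bt a' j * nO i j) →
      ∀ (𝔰 : Fin δ → (AlgebraicGeometry.Spec (.of O) ⟶ (AlgebraicGeometry.Proj (MvPolynomial.homogeneousSubmodule (Fin (3 + 1)) O)))),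
        (∀ i, 𝔰 i = (AlgebraicGeometry.Spec.map (CommRingCat.ofHom ((Localization.awayLift (MvPolynomial.eval (av i)) (MvPolynomial.X (dv i) : MvPolynomial (Fin (3 + 1)) O)
            (SectionOfVec.isUnit_eval_X (av i) (dv i) (hav i))).comp
          (algebraMap (HomogeneousLocalization.Away (MvPolynomial.homogeneousSubmodule (Fin (3 + 1)) O) (MvPolynomial.X (dv i) : MvPolynomial (Fin (3 + 1)) O))
            (Localization.Away (MvPolynomial.X (dv i) : MvPolynomial (Fin (3 + 1)) O))))) ≫
          AlgebraicGeometry.Proj.awayι (MvPolynomial.homogeneousSubmodule (Fin (3 + 1)) O) (MvPolynomial.X (dv i)) (MvPolynomial.isHomogeneous_X O (dv i)) one_pos)) →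
      ∀ (w : Fin δ → (Literature.AlgebraicGeometry.Motives.projectiveSpace 3 k).left), (∀ i, (AlgebraicGeometry.Proj.map φ hφ' : (Literature.AlgebraicGeometry.Motives.projectiveSpace 3 k).left ⟶ (AlgebraicGeometry.Proj (MvPolynomial.homogeneousSubmodule (Fin (3 + 1)) O))) (w i) = 𝔰 i (IsLocalRing.closedPoint O)) →
      ∀ z : ↥(redSub (Literature.AlgebraicGeometry.Motives.projectiveSpace 3 k).left Z hZ), IsClosed ({z} : Set ↥(redSub (Literature.AlgebraicGeometry.Motives.projectiveSpace 3 k).left Z hZ)) →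
        (¬ IsRegularLocalRing ((redSub (Literature.AlgebraicGeometry.Motives.projectiveSpace 3 k).left Z hZ).presheaf.stalk z) ↔ ∃ i, (redSubι (Literature.AlgebraicGeometry.Motives.projectiveSpace 3 k).left Z hZ z : (Literature.AlgebraicGeometry.Motives.projectiveSpace 3 k).left) = w i)) := by
  classical
  intro O _ _ _ _ _ θ hθ
  letI := MvPolynomial.gradedAlgebra (σ := Fin (3 + 1)) (R := O)
  letI := MvPolynomial.gradedAlgebra (σ := Fin (3 + 1)) (R := k)
  intro φ hφ' hφ hPint hPnoeth hPreg hqprop hqsm ℓ Z hZ e δ g B c a b v r hg hsq hZeq hℓB hr hcab hmarked hcover hvinj hZdim a₀ Bt ct Nt ha₀ hBt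
    hdett hcta₀ hψt hsect hkert hVlin Gt nO hGt hGtg hnO hn2 hnode hHess hL hF av dv hav hab 𝔰 h𝔰 w hw z hzc
  constructor
  · -- «→»: the cover clause and nose-w1's `eq_marked_point_of_isCoordVecOf`
    intro hsing
    obtain ⟨i, hi⟩ := hcover z hzc hsing
    exact ⟨i, eq_marked_point_of_isCoordVecOf k O θ hθ φ hφ' hφ hPint hPnoeth hPreg hqprop hqsm ℓ Z hZ e δ g B c a b v r hg hsq hZeq hℓB hr hcab
      hmarked hcover hvinj a₀ Bt ct Nt ha₀ hBt hdett hcta₀ hψt hsect hkert hVlin Gt nO hGt hGtg hnO hn2 hnode hHess hL hF av dv hav hab 𝔰 h𝔰 w hw i _ hi⟩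
  · -- «←»: the marked node `w i` is a non-regular point of `Z̃`
    rintro ⟨i, hi⟩
    -- the reduced trace `(λ, σ(g|_Π))~ = 𝓘⟨Z⟩` (nose-w1's Level C chain, verbatim)
    let ψk : MvPolynomial (Fin (3 + 1)) k →ₐ[k] MvPolynomial (Fin 3) k := MvPolynomial.aeval fun a' : Fin (3 + 1) => ∑ j : Fin 3, C (B a' j) * X j
    let σk : MvPolynomial (Fin 3) k → MvPolynomial (Fin (3 + 1)) k := fun G => aeval (fun i : Fin 3 => ∑ j : Fin 3, C (θ (Nt i j)) * X (r j)) G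
    have hψσk : ∀ G, ψk (σk G) = G := by
      intro G
      obtain ⟨G', rfl⟩ := MvPolynomial.map_surjective θ hθ G
      change MvPolynomial.aeval _ (aeval _ (MvPolynomial.map θ G')) = _
      rw [← map_aeval_sect θ Nt r G', ← HyperplaneLift.map_aeval_linear θ Bt B hBt, hsect]
    have hψk : ψk (∑ a', C (θ (ct a')) * X a' : MvPolynomial (Fin (3 + 1)) k) = 0 := by
      change MvPolynomial.aeval _ _ = 0
      rw [← HyperplaneLift.map_sum_C_mul_X θ ct, ← HyperplaneLift.map_aeval_linear θ Bt B hBt, hψt, map_zero]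
    have hkerk : ∀ f₀ : MvPolynomial (Fin (3 + 1)) k, ψk f₀ = 0 → (∑ a', C (θ (ct a')) * X a' : MvPolynomial (Fin (3 + 1)) k) ∣ f₀ := by
      intro f₀ hf₀
      obtain ⟨f', rfl⟩ := MvPolynomial.map_surjective θ hθ f₀
      let ψr : MvPolynomial (Fin (3 + 1)) O →+* MvPolynomial (Fin 3) O :=
        (MvPolynomial.aeval fun a' : Fin (3 + 1) => ∑ j : Fin 3, C (Bt a' j) * X j).toRingHom
      have hsectr : ∀ G, ψr (aeval (fun i : Fin 3 => ∑ j : Fin 3, C (Nt i j) * X (r j)) G) = G := fun G => hsect G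
      have hkertr : ∀ f₁, ψr f₁ = 0 → (∑ a', C (ct a') * X a' : MvPolynomial (Fin (3 + 1)) O) ∣ f₁ := fun f₁ hf₁ => hkert f₁ hf₁
      obtain ⟨m', hm'⟩ := HyperplaneAlg.dvd_sub_section ψr (fun G => aeval (fun i : Fin 3 => ∑ j : Fin 3, C (Nt i j) * X (r j)) G)
        (∑ a', C (ct a') * X a' : MvPolynomial (Fin (3 + 1)) O) hsectr hkertr f'
      have hred : MvPolynomial.map θ (ψr f') = 0 := by
        change MvPolynomial.map θ ((MvPolynomial.aeval fun a' : Fin (3 + 1) => ∑ j : Fin 3, C (Bt a' j) * X j) f') = 0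
        rw [HyperplaneLift.map_aeval_linear θ Bt B hBt]; exact hf₀
      have hf' : f' = (∑ a', C (ct a') * X a') * m' + aeval (fun i : Fin 3 => ∑ j : Fin 3, C (Nt i j) * X (r j)) (ψr f') := by
        rw [← hm']; ring
      refine ⟨MvPolynomial.map θ m', ?_⟩
      rw [hf', map_add, map_mul, HyperplaneLift.map_sum_C_mul_X, map_aeval_sect, hred, map_zero, add_zero]
    let f : Fin 2 → MvPolynomial (Fin (3 + 1)) k := ![∑ a', C (θ (ct a')) * X a', σk (restrictToHyperplane B g)]
    have hhe : (restrictToHyperplane B g).IsHomogeneous e := isHomogeneous_restrictToHyperplane B g hg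
    have hf : ∀ l, f l ∈ homogeneousSubmodule (Fin (3 + 1)) k ((![1, e] : Fin 2 → ℕ) l) := by
      intro l; fin_cases l
      · exact HyperplaneAlg.isHomogeneous_sum_C_mul_X (fun a' => θ (ct a')) id
      · exact HyperplaneAlg.isHomogeneous_aeval_linear _ (fun i => HyperplaneAlg.isHomogeneous_sum_C_mul_X _ _) _ hhe
    have hrad : (Ideal.span (Set.range f)).IsRadical :=
      NoseModel.isRadical_span_range_pair ψk.toRingHom σk _ hψk hψσk hkerk (restrictToHyperplane B g) hsq
    have hZf : Z = {y : Proj (homogeneousSubmodule (Fin (3 + 1)) k) | ∀ l, f l ∈ y.asHomogeneousIdeal} :=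
      hZeq.trans (NoseModel.setOf_pair_eq ψk.toRingHom σk _ hψσk hkerk ℓ g hVlin)
    have hJ : projIdealSheaf (homogeneousSubmodule (Fin (3 + 1)) k) ⟨Ideal.span (Set.range f), isHomogeneous_span_of_forall_mem _ f _ hf⟩ =
        vanishingIdeal (⟨Z, hZ⟩ : Closeds (Literature.AlgebraicGeometry.Motives.projectiveSpace 3 k).left) := by
      refine SatLift.projIdealSheaf_eq_vanishingIdeal _ hrad Z hZ ?_
      rw [hZf]
      ext y
      simp only [Set.mem_setOf_eq]
      change _ ↔ Ideal.span (Set.range f) ≤ _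
      rw [Ideal.span_le, Set.range_subset_iff]
      rfl
    -- the node data at `w i`: `f 1 = G(u)` with `G = g|_Π`, `u = σ-forms`; `W = θ ∘ av i`, `u_t(W) = θ(uᵢ)⁻¹ · v i t`
    obtain ⟨uO, huO, huav⟩ := hab i
    have hθu : θ uO ≠ 0 := (huO.map θ).ne_zero
    have huW : ∀ t : Fin 3, eval (fun a' => θ (av i a')) (∑ j : Fin 3, C (θ (Nt t j)) * X (r j) : MvPolynomial (Fin (3 + 1)) k) = (θ uO)⁻¹ * v i t := by
      intro t
      have h1 : (∑ j : Fin 3, C (θ (Nt t j)) * X (r j) : MvPolynomial (Fin (3 + 1)) k) =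
          MvPolynomial.map θ (∑ j : Fin 3, C (Nt t j) * X (r j) : MvPolynomial (Fin (3 + 1)) O) := by
        have h := map_aeval_sect θ Nt r (X t)
        rw [map_X, aeval_X, aeval_X] at h
        exact h.symm
      rw [h1, ← map_eval_eq θ, ← hnO i t, ← SectionFrame.mul_eval_sect Bt Nt r (nO i) (av i) uO huav hsect t, map_mul,
        ← mul_assoc, inv_mul_cancel₀ hθu, one_mul]
    have hWd : (fun a' => θ (av i a')) (dv i) = 1 := by simp only [hav i, map_one]
    have hzW : IsCoordVecOf k 3 (fun a' => θ (av i a')) (redSubι (Literature.AlgebraicGeometry.Motives.projectiveSpace 3 k).left Z hZ z) := by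
      rw [hi]; exact isCoordVecOf_of_section θ hθ φ hφ' hφ (av i) (dv i) (hav i) (w i) (by rw [← h𝔰 i]; exact hw i)
    exact not_isRegularLocalRing_redSub_stalk_of_node k Z hZ f ![1, e] hf hJ (restrictToHyperplane B g) hhe
      (fun t : Fin 3 => ∑ j : Fin 3, C (θ (Nt t j)) * X (r j)) rfl (v i) (hmarked i).2.1 (hmarked i).2.2.1
      (fun a' => θ (av i a')) (dv i) hWd (θ uO)⁻¹ (inv_ne_zero hθu) huW z hzW (hZdim z hzc) 

end CoreS7

end Summit.ResolutionOfSingularities.ResolutionOfSingularities.Cruxes.EquisingularLiftNat.Sections.Equinodal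

end
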